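import Literature.Computability.Cryptography.WordRAMArithRoutines
import Literature.Combinatorics.Enumerative.FisherYatesShuffle
import HarnessLib

/-!
# The word RAM — a verified Fisher–Yates shuffle driven by sampled words

The array shuffle of Knuth, TAOCP Vol. 2, §3.4.2, Algorithm P, in the front-to-back form of
`Literature.Combinatorics.Enumerative.fisherYates`, as structured word-RAM code
(`SProg`, `merge R H` register convention of `Literature.Computability.Cryptography.WordRAMStructured`):
with the array base `A` in register `15`, its length `N` in register `6` and a pointer `C` to
`N - 1` previously sampled words (`WordRAMRandPrefix.coinFill`) in register `40`,

* `fyInit` writes the identity arrangement `0, 1, …, N-1` at `A, …, A+N-1`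
  (`fyInit_achieves`, `6N + 4` steps);
* `fyShuffle` performs, for `i = 0, …, N-2`, `j := i + (mem[C+i] mod (N-i))`, swap of the entries
  at `A+i` and `A+j` (`fyShuffle_achieves`, `14 (N-1) + 4` steps);
* **`fisherYatesProg_achieves`**: afterwards the array holds the permutation
  `fisherYates N c`, `c i = mem[C+i]`, of `Literature.Combinatorics.Enumerative.FisherYatesShuffle`
  — so the counting results there (`card_filter_fisherYates_mem_ge`: every set of permutations is
  hit with at least its fair share of probability, up to the modulo bias) apply to the sampled
  arrangement. This is the random relabelling "`σ ∈ 𝔖_{3n}` uniformly at random" of Pratt,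
  STOC 2024, Thm. 1.9, on the machine.

Registers used: `15` (`A`), `6` (`N`) read-only; `40` (coin pointer, advanced by `N - 1`),
`41`–`47` scratch.

## References

* [KnuthTAOCP2] D. E. Knuth, *The Art of Computer Programming, Vol. 2*, §3.4.2, Algorithm P.
* T. Nipkow, G. Klein, *Concrete Semantics with Isabelle/HOL*, Springer 2014, §12.
-/

namespace Literature.Computability.Cryptography.WordRAM

open Literature.Combinatorics.Enumerative

/-! ## The permutation after `i` swaps, and the array holding it -/

/-- The swap target of step `t`: `t + (c t mod (N - t))`. [cite: KnuthTAOCP2, §3.4.2 Algorithm P] -/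
def fyJ (N : ℕ) (c : ℕ → ℕ) (t : ℕ) : ℕ := t + c t % (N - t)

/-- The arrangement after the first `i` swaps. [cite: KnuthTAOCP2, §3.4.2 Algorithm P] -/
noncomputable def fyPerm (N : ℕ) (c : ℕ → ℕ) (i : ℕ) : Equiv.Perm (Fin N) := swapProd N (fyJ N c) 0 i

/-- All `N - 1` swaps give `fisherYates`. [cite: KnuthTAOCP2, §3.4.2 Algorithm P] -/
theorem fyPerm_eq_fisherYates (N : ℕ) (c : ℕ → ℕ) : fyPerm N c (N - 1) = fisherYates N c := rfl

/-- Snoc form of `swapProd`: one more factor on the right. [folklore] -/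
theorem swapProd_succ_right (N : ℕ) (j : ℕ → ℕ) :
    ∀ (len i₀ : ℕ), swapProd N j i₀ (len + 1) = swapProd N j i₀ len * swapAt N (i₀ + len) (j (i₀ + len))
  | 0, i₀ => by simp [swapProd]
  | len + 1, i₀ => by
    rw [swapProd, swapProd_succ_right N j len (i₀ + 1), swapProd, mul_assoc,
      show i₀ + 1 + len = i₀ + (len + 1) by omega]

/-- One more swap: `fyPerm (i+1) = fyPerm i ∘ swap(i, j_i)`. [cite: KnuthTAOCP2, §3.4.2 Algorithm P] -/
theorem fyPerm_succ (N : ℕ) (c : ℕ → ℕ) (i : ℕ) :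
    fyPerm N c (i + 1) = fyPerm N c i * swapAt N i (fyJ N c i) := by
  rw [fyPerm, fyPerm, swapProd_succ_right, Nat.zero_add]

/-- The swap target lies in `[i, N)`. [folklore] -/
theorem fyJ_lt {N : ℕ} (c : ℕ → ℕ) {i : ℕ} (hi : i < N) : i ≤ fyJ N c i ∧ fyJ N c i < N := by
  have := Nat.mod_lt (c i) (show 0 < N - i by omega)
  unfold fyJ; omega

/-- The data memory with the array `fyPerm N c i` written at `A, …, A + N - 1`. [folklore] -/
noncomputable def fyHeap (H : ℕ → ℕ) (A N : ℕ) (c : ℕ → ℕ) (i : ℕ) : ℕ → ℕ := fun a =>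
  if h : A ≤ a ∧ a < A + N then ((fyPerm N c i ⟨a - A, by omega⟩ : Fin N) : ℕ) else H a

/-- Inside the array. [folklore] -/
theorem fyHeap_apply_add (H : ℕ → ℕ) (A N : ℕ) (c : ℕ → ℕ) (i : ℕ) {x : ℕ} (hx : x < N) :
    fyHeap H A N c i (A + x) = ((fyPerm N c i ⟨x, hx⟩ : Fin N) : ℕ) := by
  simp only [fyHeap]
  rw [dif_pos ⟨by omega, by omega⟩]
  congr 2; exact Fin.ext (by simp)

/-- Outside the array. [folklore] -/
theorem fyHeap_apply_of_not (H : ℕ → ℕ) (A N : ℕ) (c : ℕ → ℕ) (i : ℕ) {a : ℕ} (ha : a < A ∨ A + N ≤ a) :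
    fyHeap H A N c i a = H a := by
  simp only [fyHeap]; rw [dif_neg (by omega)]

/-- Array entries are `< N`. [folklore] -/
theorem fyHeap_lt (H : ℕ → ℕ) (A N : ℕ) (c : ℕ → ℕ) (i : ℕ) {x : ℕ} (hx : x < N) :
    fyHeap H A N c i (A + x) < N := by
  rw [fyHeap_apply_add H A N c i hx]; exact Fin.is_lt _

/-- **The swap step on the memory**: writing `a[i] := a[j]`, then `a[j] := old a[i]`, turns the
array of `fyPerm i` into the array of `fyPerm (i+1)` (`j = fyJ N c i`, `i < N`). [cite: KnuthTAOCP2, §3.4.2 Algorithm P] -/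
theorem fyHeap_succ (H : ℕ → ℕ) (A N : ℕ) (c : ℕ → ℕ) {i : ℕ} (hi : i < N) :
    fyHeap H A N c (i + 1) =
      Function.update (Function.update (fyHeap H A N c i) (A + i) (fyHeap H A N c i (A + fyJ N c i)))
        (A + fyJ N c i) (fyHeap H A N c i (A + i)) := by
  obtain ⟨hj1, hj2⟩ := fyJ_lt c hi
  set jj := fyJ N c i with hjj
  have hswap : ∀ y : Fin N, fyPerm N c (i + 1) y = fyPerm N c i (swapAt N i jj y) := by
    intro y; rw [fyPerm_succ]; rfl
  have hswapAt : swapAt N i jj = Equiv.swap (⟨i, hi⟩ : Fin N) ⟨jj, hj2⟩ := by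
    unfold swapAt; rw [dif_pos ⟨hi, hj2⟩]
  funext a
  by_cases hin : A ≤ a ∧ a < A + N
  · obtain ⟨x, rfl⟩ : ∃ x, a = A + x := ⟨a - A, by omega⟩
    have hx : x < N := by omega
    rw [fyHeap_apply_add H A N c (i + 1) hx, hswap, hswapAt,
      fyHeap_apply_add H A N c i hj2, fyHeap_apply_add H A N c i hi]
    -- compare with the two updates, by cases on `x = jj`, `x = i`
    by_cases hxj : x = jj
    · subst hxj
      rw [Function.update_self, Equiv.swap_apply_right]
    · rw [Function.update_of_ne (by omega)]
      by_cases hxi : x = i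
      · subst hxi
        rw [Function.update_self, Equiv.swap_apply_left]
      · rw [Function.update_of_ne (by omega), fyHeap_apply_add H A N c i hx,
          Equiv.swap_apply_of_ne_of_ne (fun e => hxi (Fin.mk.inj_iff.1 e))
            (fun e => hxj (Fin.mk.inj_iff.1 e))]
  · rw [fyHeap_apply_of_not H A N c (i + 1) (by omega), Function.update_of_ne (by omega),
      Function.update_of_ne (by omega), fyHeap_apply_of_not H A N c i (by omega)]

/-- Before any swap the array is the identity arrangement. [folklore] -/
theorem fyHeap_zero_apply_add (H : ℕ → ℕ) (A N : ℕ) (c : ℕ → ℕ) {x : ℕ} (hx : x < N) :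
    fyHeap H A N c 0 (A + x) = x := by
  rw [fyHeap_apply_add H A N c 0 hx]; rfl

namespace SProg

variable {w : ℕ} {O : List ℕ → List ℕ}

/-! ## Writing the identity arrangement -/

/-- `a[x] := x` for `x < N`: `p := A; x := 0; cnt := N; while cnt ≠ 0 { mem[p] := x; p++; x++; cnt-- }`
(registers `42, 41, 43`). [folklore] -/
def fyInit : SProg :=
  seq (block [(.add, .dir 42, .dir 15, .imm 0), (.add, .dir 41, .imm 0, .imm 0),
      (.add, .dir 43, .dir 6, .imm 0)])
    (whilenz (.dir 43) (block [(.add, .ind 42, .dir 41, .imm 0), (.add, .dir 42, .dir 42, .imm 1),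
      (.add, .dir 41, .dir 41, .imm 1), (.sub, .dir 43, .dir 43, .imm 1)]))

/-- `fyInit` makes no oracle query. [folklore] -/
theorem fyInit_queryFree : fyInit.QueryFree := ⟨block_queryFree _, block_queryFree _⟩

/-- The identity arrangement of length `x` written at `A`. [folklore] -/
def idFill (H : ℕ → ℕ) (A x : ℕ) : ℕ → ℕ := fun a => if A ≤ a ∧ a < A + x then a - A else H a

/-- The full identity arrangement is the array of `fyPerm 0`. [folklore] -/
theorem idFill_eq_fyHeap (H : ℕ → ℕ) (A N : ℕ) (c : ℕ → ℕ) : idFill H A N = fyHeap H A N c 0 := by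
  funext a
  by_cases h : A ≤ a ∧ a < A + N
  · obtain ⟨x, rfl⟩ : ∃ x, a = A + x := ⟨a - A, by omega⟩
    rw [fyHeap_zero_apply_add H A N c (by omega)]
    simp [idFill, h]
  · rw [fyHeap_apply_of_not H A N c 0 (by omega)]
    simp [idFill, h]

set_option linter.unusedSimpArgs false in
/-- **Semantics of `fyInit`**: with `A ≥ 100` in `15` and `N` in `6` (`A + N < 2 ^ w`), `fyInit`
writes `0, …, N-1` at `A, …, A+N-1` within `6N + 4` steps; registers other than `41, 42, 43`
are kept. [folklore] -/
theorem fyInit_achieves {R H : ℕ → ℕ} {A N : ℕ} (h15 : R 15 = A) (h6 : R 6 = N) (hA : 100 ≤ A)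
    (hw : A + N < 2 ^ w) :
    Achieves w O fyInit (merge R H)
      (fun m => ∃ R', m = merge R' (idFill H A N) ∧ ∀ a, a ≠ 41 → a ≠ 42 → a ≠ 43 → R' a = R a)
      (6 * N + 4) := by
  -- invariant after `x` iterations
  let Inv : ℕ → (ℕ → ℕ) → Prop := fun x m => ∃ S, m = merge S (idFill H A x) ∧ S 41 = x ∧
    S 42 = A + x ∧ S 43 = N - x ∧ ∀ a, a ≠ 41 → a ≠ 42 → a ≠ 43 → S a = R a
  have hset : Achieves w O (block [(.add, .dir 42, .dir 15, .imm 0), (.add, .dir 41, .imm 0, .imm 0),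
      (.add, .dir 43, .dir 6, .imm 0)]) (merge R H) (Inv 0) 3 := by
    refine Achieves.block ?_ le_rfl
    refine ⟨Function.update (Function.update (Function.update R 42 A) 41 0) 43 N, ?_, by simp,
      by simp, by simp, fun a h1 h2 h3 => by simp [h1, h2, h3]⟩
    have hid : idFill H A 0 = H := by funext a; simp [idFill]
    rw [hid]
    simp -failIfUnchanged (disch := omega) only [execOps_cons, execOps_nil, execOp, Operand.write,
      Operand.read, merge_apply_of_lt, merge_apply_of_le, Function.update_self,
      Function.update_of_ne, update_merge_of_lt, update_merge_of_le, h15, h6, ne_eq,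
      OfNat.ofNat_ne_zero, Nat.reduceEqDiff]
    rw [BinOp.eval_add_eq (Nat.add_zero A) (by omega), BinOp.eval_add_eq rfl (by omega),
      BinOp.eval_add_eq (Nat.add_zero N) (by omega)]
  have hbody : ∀ x, x < N → ∀ m, Inv x m → (Operand.dir 43).read m ≠ 0 ∧
      Achieves w O (block [(.add, .ind 42, .dir 41, .imm 0), (.add, .dir 42, .dir 42, .imm 1),
        (.add, .dir 41, .dir 41, .imm 1), (.sub, .dir 43, .dir 43, .imm 1)]) m (Inv (x + 1)) 4 := by
    rintro x hx m ⟨S, rfl, h41, h42, h43, hS⟩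
    refine ⟨by rw [Operand.read_dir_merge (by norm_num), h43]; omega, Achieves.block ?_ le_rfl⟩
    refine ⟨Function.update (Function.update (Function.update S 42 (A + x + 1)) 41 (x + 1)) 43
      (N - x - 1), ?_, by simp, by simp; omega, by simp; omega,
      fun a h1 h2 h3 => by simp [h1, h2, h3, hS a h1 h2 h3]⟩
    have e0 : BinOp.eval w .add x 0 = x := BinOp.eval_add_eq (Nat.add_zero x) (by omega)
    have e1 : BinOp.eval w .add (A + x) 1 = A + x + 1 := BinOp.eval_add_eq rfl (by omega)
    have e2 : BinOp.eval w .add x 1 = x + 1 := BinOp.eval_add_eq rfl (by omega)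
    have e3 : BinOp.eval w .sub (N - x) 1 = N - x - 1 :=
      BinOp.eval_sub_eq (show 1 ≤ N - x by omega) (by omega) rfl
    simp -failIfUnchanged (disch := omega) only [execOps_cons, execOps_nil, execOp, Operand.write,
      Operand.read, merge_apply_of_lt, merge_apply_of_le, Function.update_self,
      Function.update_of_ne, update_merge_of_lt, update_merge_of_le, h41, h42, h43, ne_eq,
      OfNat.ofNat_ne_zero, Nat.reduceEqDiff, e0, e1, e2, e3]
    congr 1
    funext a
    simp only [idFill, Function.update_apply]
    split_ifs <;> omega
  have hloop : ∀ m, Inv 0 m → Achieves w O (whilenz (.dir 43) (block [(.add, .ind 42, .dir 41, .imm 0),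
      (.add, .dir 42, .dir 42, .imm 1), (.add, .dir 41, .dir 41, .imm 1), (.sub, .dir 43, .dir 43, .imm 1)]))
      m (fun m => ∃ R', m = merge R' (idFill H A N) ∧ ∀ a, a ≠ 41 → a ≠ 42 → a ≠ 43 → R' a = R a)
      (N * (4 + 2) + 1) := fun m hm =>
    Achieves.whilenz N 4 Inv hbody (fun m ⟨S, hm, _, _, h43, _⟩ => by
        rw [hm, Operand.read_dir_merge (by norm_num), h43, Nat.sub_self]) hm
      (fun m ⟨S, hm, _, _, _, hS⟩ => ⟨S, hm, hS⟩) le_rfl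
  exact (Achieves.seq hset hloop).mono (fun _ h => h) (by omega)

/-! ## The shuffle loop -/

/-- The body of the shuffle loop: `m := N - i; t := mem[C]; t := t mod m; t := t + p; x := mem[p];
y := mem[t]; mem[p] := y; mem[t] := x; p++; i++; C++; cnt--` (registers: `6 = N`, `40 = C + i`,
`41 = i`, `42 = A + i`, `43 = N - 1 - i`, scratch `44`–`47`). [cite: KnuthTAOCP2, §3.4.2 Algorithm P] -/
def fyBody : List OpSpec :=
  [(.sub, .dir 44, .dir 6, .dir 41), (.add, .dir 45, .ind 40, .imm 0), (.mod, .dir 45, .dir 45, .dir 44),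
    (.add, .dir 45, .dir 45, .dir 42), (.add, .dir 46, .ind 42, .imm 0), (.add, .dir 47, .ind 45, .imm 0),
    (.add, .ind 42, .dir 47, .imm 0), (.add, .ind 45, .dir 46, .imm 0), (.add, .dir 42, .dir 42, .imm 1),
    (.add, .dir 41, .dir 41, .imm 1), (.add, .dir 40, .dir 40, .imm 1), (.sub, .dir 43, .dir 43, .imm 1)]

/-- The shuffle loop: `p := A; i := 0; cnt := N - 1; while cnt ≠ 0 { fyBody }`. [cite: KnuthTAOCP2, §3.4.2 Algorithm P] -/
def fyShuffle : SProg :=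
  seq (block [(.add, .dir 42, .dir 15, .imm 0), (.add, .dir 41, .imm 0, .imm 0),
      (.sub, .dir 43, .dir 6, .imm 1)])
    (whilenz (.dir 43) (block fyBody))

/-- `fyShuffle` makes no oracle query. [folklore] -/
theorem fyShuffle_queryFree : fyShuffle.QueryFree := ⟨block_queryFree _, block_queryFree _⟩

/-- The scratch registers of the shuffle are `40`–`47`. [folklore] -/
def fyScratch (a : ℕ) : Prop := 40 ≤ a ∧ a ≤ 47

set_option linter.unusedSimpArgs false in
set_option maxHeartbeats 800000 in
/-- One iteration of the shuffle loop. [cite: KnuthTAOCP2, §3.4.2 Algorithm P] -/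
theorem fyBody_step {R H : ℕ → ℕ} {A N C : ℕ} (c : ℕ → ℕ) (hA : 100 ≤ A) (hC : 100 ≤ C)
    (hdisj : A + N ≤ C ∨ C + (N - 1) ≤ A) (hAw : A + N < 2 ^ w) (hCw : C + N < 2 ^ w)
    (hcoin : ∀ t, t < N - 1 → H (C + t) = c t ∧ c t < 2 ^ w) {i : ℕ} (hi : i < N - 1)
    {S : ℕ → ℕ} (h6 : S 6 = N) (h40 : S 40 = C + i) (h41 : S 41 = i) (h42 : S 42 = A + i)
    (h43 : S 43 = N - 1 - i) (hS : ∀ a, ¬ fyScratch a → S a = R a) :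
    ∃ S', execOps w (merge S (fyHeap H A N c i)) fyBody = merge S' (fyHeap H A N c (i + 1)) ∧
      S' 6 = N ∧ S' 40 = C + (i + 1) ∧ S' 41 = i + 1 ∧ S' 42 = A + (i + 1) ∧
      S' 43 = N - 1 - (i + 1) ∧ ∀ a, ¬ fyScratch a → S' a = R a := by
  obtain ⟨hj1, hj2⟩ := fyJ_lt c (show i < N by omega)
  set jj := fyJ N c i with hjj
  have hcoinC : fyHeap H A N c i (C + i) = c i := by
    rw [fyHeap_apply_of_not H A N c i (by omega)]; exact (hcoin i hi).1
  have hci : c i < 2 ^ w := (hcoin i hi).2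
  have hmod : c i % (N - i) + (A + i) = A + jj := by rw [hjj, fyJ]; omega
  have hxi : fyHeap H A N c i (A + i) < N := fyHeap_lt H A N c i (by omega)
  have hxj : fyHeap H A N c i (A + jj) < N := fyHeap_lt H A N c i hj2
  set xv := fyHeap H A N c i (A + i) with hxv
  set yv := fyHeap H A N c i (A + jj) with hyv
  refine ⟨Function.update (Function.update (Function.update (Function.update (Function.update
    (Function.update (Function.update (Function.update S 44 (N - i)) 45 (A + jj)) 46 xv) 47 yv)
    42 (A + (i + 1))) 41 (i + 1)) 40 (C + (i + 1))) 43 (N - 1 - (i + 1)), ?_, by simp [h6],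
    by simp, by simp, by simp, by simp, fun a ha => ?_⟩
  · have e1 : BinOp.eval w .sub N i = N - i := BinOp.eval_sub_eq (show i ≤ N by omega) (by omega) rfl
    have e2 : BinOp.eval w .add (c i) 0 = c i := BinOp.eval_add_eq (Nat.add_zero (c i)) hci
    have e3 : BinOp.eval w .add (c i % (N - i)) (A + i) = A + jj := BinOp.eval_add_eq hmod (by omega)
    have e4 : BinOp.eval w .add xv 0 = xv := BinOp.eval_add_eq (Nat.add_zero xv) (by omega)
    have e5 : BinOp.eval w .add yv 0 = yv := BinOp.eval_add_eq (Nat.add_zero yv) (by omega)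
    have e6 : BinOp.eval w .add (A + i) 1 = A + (i + 1) := BinOp.eval_add_eq (by omega) (by omega)
    have e7 : BinOp.eval w .add i 1 = i + 1 := BinOp.eval_add_eq rfl (by omega)
    have e8 : BinOp.eval w .add (C + i) 1 = C + (i + 1) := BinOp.eval_add_eq (by omega) (by omega)
    have e9 : BinOp.eval w .sub (N - 1 - i) 1 = N - 1 - (i + 1) :=
      BinOp.eval_sub_eq (show 1 ≤ N - 1 - i by omega) (by omega) (by omega)
    unfold fyBody
    simp -failIfUnchanged (disch := omega) only [execOps_cons, execOps_nil, execOp, Operand.write,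
      Operand.read, merge_apply_of_lt, merge_apply_of_le, Function.update_self,
      Function.update_of_ne, update_merge_of_lt, update_merge_of_le, h6, h40, h41, h42, h43, ne_eq,
      OfNat.ofNat_ne_zero, Nat.reduceEqDiff, BinOp.eval_mod, hcoinC, e1, e2, e3, ← hxv, ← hyv, e4,
      e5, e6, e7, e8, e9]
    congr 1
    · funext a
      simp only [Function.update_apply]
      split_ifs <;> rfl
    · rw [fyHeap_succ H A N c (show i < N by omega)]
  · have : a ≠ 44 ∧ a ≠ 45 ∧ a ≠ 46 ∧ a ≠ 47 ∧ a ≠ 42 ∧ a ≠ 41 ∧ a ≠ 40 ∧ a ≠ 43 := by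
      unfold fyScratch at ha; omega
    simp [this, hS a ha]

set_option linter.unusedSimpArgs false in
/-- **Semantics of `fyShuffle`**: with the array of `fyPerm 0` (the identity) at `A`, `N` in `6`,
`A` in `15`, and the coin pointer `C` in `40` (`N - 1` words `c 0, …, c (N-2)` below `2 ^ w` at
`C, …`; the two segments disjoint data segments without wrap-around), the loop ends within
`14 (N - 1) + 4` steps with the array of `fyPerm (N-1) = fisherYates N c` at `A`, the coin pointer
advanced to `C + (N - 1)`, and all registers outside `40`–`47` kept. [cite: KnuthTAOCP2, §3.4.2 Algorithm P] -/
theorem fyShuffle_achieves {R H : ℕ → ℕ} {A N C : ℕ} (c : ℕ → ℕ) (h15 : R 15 = A) (h6 : R 6 = N)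
    (h40 : R 40 = C) (hA : 100 ≤ A) (hC : 100 ≤ C) (hN : 1 ≤ N)
    (hdisj : A + N ≤ C ∨ C + (N - 1) ≤ A) (hAw : A + N < 2 ^ w) (hCw : C + N < 2 ^ w)
    (hcoin : ∀ t, t < N - 1 → H (C + t) = c t ∧ c t < 2 ^ w) :
    Achieves w O fyShuffle (merge R (fyHeap H A N c 0))
      (fun m => ∃ R', m = merge R' (fyHeap H A N c (N - 1)) ∧ R' 40 = C + (N - 1) ∧
        ∀ a, ¬ fyScratch a → R' a = R a)
      (14 * (N - 1) + 4) := by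
  let Inv : ℕ → (ℕ → ℕ) → Prop := fun i m => ∃ S, m = merge S (fyHeap H A N c i) ∧ S 6 = N ∧
    S 40 = C + i ∧ S 41 = i ∧ S 42 = A + i ∧ S 43 = N - 1 - i ∧ ∀ a, ¬ fyScratch a → S a = R a
  have hset : Achieves w O (block [(.add, .dir 42, .dir 15, .imm 0), (.add, .dir 41, .imm 0, .imm 0),
      (.sub, .dir 43, .dir 6, .imm 1)]) (merge R (fyHeap H A N c 0)) (Inv 0) 3 := by
    refine Achieves.block ?_ le_rfl
    refine ⟨Function.update (Function.update (Function.update R 42 A) 41 0) 43 (N - 1), ?_,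
      by simp [h6], by simp [h40], by simp, by simp, by simp, fun a ha => ?_⟩
    · simp -failIfUnchanged (disch := omega) only [execOps_cons, execOps_nil, execOp, Operand.write,
        Operand.read, merge_apply_of_lt, merge_apply_of_le, Function.update_self,
        Function.update_of_ne, update_merge_of_lt, update_merge_of_le, h15, h6, ne_eq,
        OfNat.ofNat_ne_zero, Nat.reduceEqDiff]
      rw [BinOp.eval_add_eq (Nat.add_zero A) (by omega), BinOp.eval_add_eq rfl (by omega),
        BinOp.eval_sub_eq hN (by omega) rfl]
    · have : a ≠ 42 ∧ a ≠ 41 ∧ a ≠ 43 := by unfold fyScratch at ha; omega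
      simp [this]
  have hbody : ∀ i, i < N - 1 → ∀ m, Inv i m → (Operand.dir 43).read m ≠ 0 ∧
      Achieves w O (block fyBody) m (Inv (i + 1)) 12 := by
    rintro i hi m ⟨S, rfl, hS6, hS40, hS41, hS42, hS43, hS⟩
    refine ⟨by rw [Operand.read_dir_merge (by norm_num), hS43]; omega, Achieves.block ?_ le_rfl⟩
    obtain ⟨S', hex, h1, h2, h3, h4, h5, h7⟩ := fyBody_step (R := R) c hA hC hdisj hAw hCw hcoin hi
      hS6 hS40 hS41 hS42 hS43 hS
    exact ⟨S', hex, h1, h2, h3, h4, h5, h7⟩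
  have hloop : ∀ m, Inv 0 m → Achieves w O (whilenz (.dir 43) (block fyBody)) m
      (fun m => ∃ R', m = merge R' (fyHeap H A N c (N - 1)) ∧ R' 40 = C + (N - 1) ∧
        ∀ a, ¬ fyScratch a → R' a = R a) ((N - 1) * (12 + 2) + 1) := fun m hm =>
    Achieves.whilenz (N - 1) 12 Inv hbody (fun m ⟨S, hm, _, _, _, _, h43, _⟩ => by
        rw [hm, Operand.read_dir_merge (by norm_num), h43, Nat.sub_self]) hm
      (fun m ⟨S, hm, _, h40', _, _, _, hS⟩ => ⟨S, hm, h40', hS⟩) le_rfl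
  exact (Achieves.seq hset hloop).mono (fun _ h => h) (by omega)

/-! ## The whole routine -/

/-- **The Fisher–Yates routine**: identity arrangement, then the shuffle. [cite: KnuthTAOCP2, §3.4.2 Algorithm P] -/
def fisherYatesProg : SProg := seq fyInit fyShuffle

/-- `fisherYatesProg` makes no oracle query. [folklore] -/
theorem fisherYatesProg_queryFree : fisherYatesProg.QueryFree := ⟨fyInit_queryFree, fyShuffle_queryFree⟩

/-- **Semantics of the Fisher–Yates routine.** With the array base `A ≥ 100` in `15`, `N ≥ 1` in
`6`, and in `40` a pointer `C ≥ 100` to `N - 1` words `c 0, …, c (N-2)` (each `< 2 ^ w`), the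
segments `[A, A+N)` and `[C, C+N-1)` disjoint and below `2 ^ w`: within `20 N + 8` steps the
array at `A` holds the permutation `fisherYates N c` of `Literature.Combinatorics.Enumerative`
(entry `x` at `A + x`), the rest of the data is untouched, the coin pointer is advanced to
`C + (N - 1)`, and every register outside `40`–`47` is kept. [cite: KnuthTAOCP2, §3.4.2 Algorithm P] -/
theorem fisherYatesProg_achieves {R H : ℕ → ℕ} {A N C : ℕ} (c : ℕ → ℕ) (h15 : R 15 = A)
    (h6 : R 6 = N) (h40 : R 40 = C) (hA : 100 ≤ A) (hC : 100 ≤ C) (hN : 1 ≤ N)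
    (hdisj : A + N ≤ C ∨ C + (N - 1) ≤ A) (hAw : A + N < 2 ^ w) (hCw : C + N < 2 ^ w)
    (hcoin : ∀ t, t < N - 1 → H (C + t) = c t ∧ c t < 2 ^ w) :
    Achieves w O fisherYatesProg (merge R H)
      (fun m => ∃ R' H', m = merge R' H' ∧ R' 40 = C + (N - 1) ∧ (∀ a, ¬ fyScratch a → R' a = R a) ∧
        (∀ x (hx : x < N), H' (A + x) = ((fisherYates N c ⟨x, hx⟩ : Fin N) : ℕ)) ∧
        (∀ a, a < A ∨ A + N ≤ a → H' a = H a))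
      (20 * N + 8) := by
  have h1 := fyInit_achieves (O := O) (w := w) (H := H) h15 h6 hA hAw
  have h2 : ∀ m, (∃ R', m = merge R' (idFill H A N) ∧ ∀ a, a ≠ 41 → a ≠ 42 → a ≠ 43 → R' a = R a) →
      Achieves w O fyShuffle m
        (fun m => ∃ R' H', m = merge R' H' ∧ R' 40 = C + (N - 1) ∧ (∀ a, ¬ fyScratch a → R' a = R a) ∧
          (∀ x (hx : x < N), H' (A + x) = ((fisherYates N c ⟨x, hx⟩ : Fin N) : ℕ)) ∧
          (∀ a, a < A ∨ A + N ≤ a → H' a = H a))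
        (14 * (N - 1) + 4) := by
    rintro m ⟨R₁, hm, hR₁⟩
    have h15' : R₁ 15 = A := by rw [hR₁ 15 (by norm_num) (by norm_num) (by norm_num), h15]
    have h6' : R₁ 6 = N := by rw [hR₁ 6 (by norm_num) (by norm_num) (by norm_num), h6]
    have h40' : R₁ 40 = C := by rw [hR₁ 40 (by norm_num) (by norm_num) (by norm_num), h40]
    rw [hm, idFill_eq_fyHeap H A N c]
    refine (fyShuffle_achieves (O := O) c h15' h6' h40' hA hC hN hdisj hAw hCw hcoin).mono
      (fun m ⟨R', hm', h40'', hR'⟩ => ⟨R', fyHeap H A N c (N - 1), hm', h40'', fun a ha => ?_,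
        fun x hx => fyHeap_apply_add H A N c (N - 1) hx, fun a ha => fyHeap_apply_of_not H A N c _ ha⟩)
      le_rfl
    rw [hR' a ha]
    have : a ≠ 41 ∧ a ≠ 42 ∧ a ≠ 43 := by unfold fyScratch at ha; omega
    exact hR₁ a this.1 this.2.1 this.2.2
  exact (Achieves.seq h1 h2).mono (fun _ h => h) (by omega)

end SProg

end Literature.Computability.Cryptography.WordRAM
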